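import Literature.Combinatorics.Additive.BalogSzemerediGowers
import Mathlib.Combinatorics.Additive.PluenneckeRuzsa

/-!
# Proof of the Balog–Szemerédi–Gowers theorem, energy form (`Zhao2023_thm7136_holds`)

Discharges the named fact `Literature.Combinatorics.Additive.Zhao2023_thm7136`
(Y. Zhao, *Graph Theory and Additive Combinatorics*, CUP 2023, Theorem 7.13.6): if
`E(A) ≥ |A|³/K` then some `A' ⊆ A` has `|A| ≤ C K^C |A'|` and `|A' + A'| ≤ C K^C |A'|`; here with
`C = 2^28` (precisely `|A| ≤ 16K|A'|`, `|A' + A'| ≤ 2^28 K^12 |A'|`).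

The argument is Gowers' proof of the Balog–Szemerédi–Gowers theorem (W. T. Gowers, *A new proof of
Szemerédi's theorem*, GAFA 11 (2001)): popular differences and paths of length two — in Zhao's
presentation the "path of length 2 lemma" (Lemma 7.13.10, dependent random choice) and the
popular-vertex / common-neighbour count from the proofs of Lemma 7.13.11 and Theorem 7.13.9 — written
in pure counting form for an arbitrary abelian group. The arrangement follows the Lean library
`add-combi` (`AddCombi/BSG.lean`, Y. Dillies and B. Mehta), which is stated for finite groups with
densities and discrete convolutions and is therefore re-derived here with cardinalities
(`Finset.card`, `Finset.addEnergy`). It yields `A' ⊆ A` with `|A| ≤ 16K|A'|` and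
`|A' - A'| ≤ 2^14 K^6 |A'|` (`bsg_self_sub`); the Ruzsa triangle inequality
`|A' + A'| |A'| ≤ |A' - A'|²` (Mathlib `Finset.ruzsa_triangle_inequality_add_sub_sub`) converts
differences to sums, as in Zhao's deduction of Theorem 7.13.6 from Theorem 7.13.7 (Corollary 7.3.6).

Notation in the docstrings: `r(x) = #{(a, b) ∈ A × B : a + b = x}`, the slice
`X_x = {a ∈ A : x - a ∈ B}` (so `#X_x = r(x)`), and `d(y) = #{(b, b') ∈ B × B : b - b' = y}`.

Also discharged here (Step 6): `energy_partialSumset` (T. Tao, V. Vu, *Additive Combinatorics*,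
CUP 2006, Lemma 2.30, second assertion, pp. 86–87): `E(A, B) ≥ |A|^{3/2}|B|^{3/2}/K` gives the graph
`G` of popular sums with `|G| ≥ |A||B|/(2K)` and `|A +_G B| ≤ 2K|A|^{1/2}|B|^{1/2}` — the printed
popular-sums argument (it is also Zhao's proof that Theorem 7.13.9 implies Theorem 7.13.7).

Deliberately NOT here: the two-set / graph forms (Zhao Theorems 7.13.7, 7.13.9; Tao–Vu Theorem 2.29
remains the named fact `balogSzemerediGowers`), paths of length three, polynomial-loss refinements.
-/

namespace Literature.Combinatorics.Additive

open Finset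
open scoped Pointwise

section BSGProof

open scoped _root_.Combinatorics.Additive

variable {G : Type*} [AddCommGroup G] [DecidableEq G]

/-! #### Step 1. Representation counts `r(x) = #{(a,b) ∈ A × B : a + b = x} = #(A ∩ (x - B))`. -/

/-- The representation count `r(x) = #{(a, b) ∈ A × B : a + b = x}` is the size of the slice
`X_x = {a ∈ A : x - a ∈ B}` (bijection `(a, b) ↦ a`, inverse `a ↦ (a, x - a)`). [folklore] -/
theorem bsg_card_rep_eq (A B : Finset G) (x : G) :
    #{ab ∈ A ×ˢ B | ab.1 + ab.2 = x} = #{a ∈ A | x - a ∈ B} := by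
  refine card_nbij' (fun ab => ab.1) (fun a => (a, x - a)) ?_ ?_ ?_ ?_
  · rintro ⟨a, b⟩ hab
    simp only [mem_coe, mem_filter, mem_product] at hab ⊢
    obtain ⟨⟨ha, hb⟩, rfl⟩ := hab
    exact ⟨ha, by simpa using hb⟩
  · intro a ha
    simp only [mem_coe, mem_filter, mem_product] at ha ⊢
    exact ⟨⟨ha.1, ha.2⟩, by abel⟩
  · rintro ⟨a, b⟩ hab
    simp only [mem_coe, mem_filter, mem_product] at hab
    obtain ⟨-, rfl⟩ := hab
    simp
  · intro a _
    simp

/-- `∑_{x ∈ A + B} r(x) = |A| |B|` (fibres of `(a, b) ↦ a + b`). [folklore] -/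
theorem bsg_sum_rep (A B : Finset G) :
    ∑ x ∈ A + B, #{ab ∈ A ×ˢ B | ab.1 + ab.2 = x} = #A * #B := by
  rw [← card_product]
  exact (card_eq_sum_card_fiberwise (f := fun ab : G × G => ab.1 + ab.2) fun ab hab => by
    simp only [mem_coe, mem_product] at hab
    exact mem_coe.2 (add_mem_add hab.1 hab.2)).symm

/-- `r(x) ≤ |B|`: a representation `x = a + b` is determined by `b`.
[cite: Zhao2023, §7.13, proof that Theorem 7.13.9 implies Theorem 7.13.7 (`r_{A,B}(x) ≤ |A|`)] -/
theorem bsg_rep_le_card_right (A B : Finset G) (x : G) :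
    #{ab ∈ A ×ˢ B | ab.1 + ab.2 = x} ≤ #B := by
  refine card_le_card_of_injOn Prod.snd (fun ab hab => ?_) ?_
  · simp only [mem_coe, mem_filter, mem_product] at hab
    exact hab.1.2
  · rintro ⟨a₁, b₁⟩ h₁ ⟨a₂, b₂⟩ h₂ (h : b₁ = b₂)
    simp only [mem_coe, mem_filter, mem_product] at h₁ h₂
    subst h
    have : a₁ = a₂ := add_right_cancel (h₁.2.trans h₂.2.symm)
    rw [this]

/-- Fibrewise summation: `∑_{(a,b) ∈ A × B} f (a + b) = ∑_{x ∈ A + B} r(x) f(x)`. [folklore] -/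
theorem bsg_sum_pair_eq (A B : Finset G) (f : G → ℝ) :
    ∑ ab ∈ A ×ˢ B, f (ab.1 + ab.2) =
      ∑ x ∈ A + B, (#{ab ∈ A ×ˢ B | ab.1 + ab.2 = x} : ℝ) * f x := by
  rw [← sum_fiberwise_of_maps_to' (g := fun ab : G × G => ab.1 + ab.2) (t := A + B)
    (fun ab hab => add_mem_add (mem_product.1 hab).1 (mem_product.1 hab).2) f]
  simp only [sum_const, nsmul_eq_mul]

/-- Cauchy–Schwarz on the energy: `E(A, B) = ∑_x r(x)²` (Mathlib `Finset.addEnergy_eq_sum_sq'`),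
hence `E(A, B)² = (∑_{(a,b)} r(a + b))² ≤ |A||B| ∑_{(a,b)} r(a + b)² = |A||B| ∑_x r(x)³`.
[cite: Zhao2023, Remark 7.13.2 and proof of Proposition 7.13.4 (energy as `∑ r²`, Cauchy–Schwarz)] -/
theorem bsg_energy_sq_le (A B : Finset G) :
    (E[A, B] : ℝ) ^ 2 ≤ #A * #B * ∑ x ∈ A + B,
      (#{ab ∈ A ×ˢ B | ab.1 + ab.2 = x} : ℝ) * (#{ab ∈ A ×ˢ B | ab.1 + ab.2 = x} : ℝ) ^ 2 := by
  have hfib := bsg_sum_pair_eq A B (fun x => (#{ab ∈ A ×ˢ B | ab.1 + ab.2 = x} : ℝ) ^ 2)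
  have hE := bsg_sum_pair_eq A B (fun x => (#{ab ∈ A ×ˢ B | ab.1 + ab.2 = x} : ℝ))
  beta_reduce at hfib hE
  have hE' : (E[A, B] : ℝ) =
      ∑ ab ∈ A ×ˢ B, (#{cd ∈ A ×ˢ B | cd.1 + cd.2 = ab.1 + ab.2} : ℝ) := by
    rw [hE, addEnergy_eq_sum_sq']
    push_cast
    exact sum_congr rfl fun x _ => by ring
  rw [← hfib, hE']
  calc (∑ ab ∈ A ×ˢ B, (#{cd ∈ A ×ˢ B | cd.1 + cd.2 = ab.1 + ab.2} : ℝ)) ^ 2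
      = (∑ ab ∈ A ×ˢ B, 1 * (#{cd ∈ A ×ˢ B | cd.1 + cd.2 = ab.1 + ab.2} : ℝ)) ^ 2 := by
        simp only [one_mul]
    _ ≤ (∑ _ab ∈ A ×ˢ B, (1 : ℝ) ^ 2) *
          ∑ ab ∈ A ×ˢ B, (#{cd ∈ A ×ˢ B | cd.1 + cd.2 = ab.1 + ab.2} : ℝ) ^ 2 :=
        sum_mul_sq_le_sq_mul_sq _ _ _
    _ = #A * #B * ∑ ab ∈ A ×ˢ B, (#{cd ∈ A ×ˢ B | cd.1 + cd.2 = ab.1 + ab.2} : ℝ) ^ 2 := by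
        simp [card_product]

/-! #### Step 2. Few representations of unpopular differences inside the slices. -/

/-- The number of `x` with `x - a ∈ B` and `x - a' ∈ B` (common neighbours of `a, a'`) is at most
`d(a - a') = #{(b, b') ∈ B × B : b - b' = a - a'}` (injection `x ↦ (x - a', x - a)`). [folklore] -/
theorem bsg_card_common_le (A B : Finset G) (a a' : G) :
    #{x ∈ A + B | x - a ∈ B ∧ x - a' ∈ B} ≤ #{bb ∈ B ×ˢ B | bb.1 - bb.2 = a - a'} := by
  refine card_le_card_of_injOn (fun x => (x - a', x - a)) (fun x hx => ?_) ?_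
  · simp only [mem_coe, mem_filter, mem_product] at hx ⊢
    exact ⟨⟨hx.2.2, hx.2.1⟩, by abel⟩
  · intro x₁ _ x₂ _ h
    simp only [Prod.mk.injEq] at h
    exact sub_left_injective h.1

/-- **Unfriendly pairs are rarely seen from a random slice** (the expectation bound in the path of
length 2 lemma, additive form): `∑_x r(x) · #{(a, a') ∈ X_x × X_x : d(a - a') < t} ≤ |B| · |A|² · t`,
because `r(x) ≤ |B|`, and after swapping the sums each unfriendly pair `(a, a')` lies in at most
`d(a - a') < t` slices. [cite: Zhao2023, Lemma 7.13.10 (path of length 2 lemma), proof — bound on `𝔼X`] -/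
theorem bsg_sum_bad_le (A B : Finset G) {t : ℝ} (ht : 0 ≤ t) :
    ∑ x ∈ A + B, (#{ab ∈ A ×ˢ B | ab.1 + ab.2 = x} : ℝ) *
      #{p ∈ {a ∈ A | x - a ∈ B} ×ˢ {a ∈ A | x - a ∈ B} |
          (#{bb ∈ B ×ˢ B | bb.1 - bb.2 = p.1 - p.2} : ℝ) < t}
    ≤ #B * (#A ^ 2 * t) := by
  set Hbad : Finset (G × G) :=
    {q ∈ A ×ˢ A | (#{bb ∈ B ×ˢ B | bb.1 - bb.2 = q.1 - q.2} : ℝ) < t} with hHbad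
  have hset : ∀ x : G, {p ∈ {a ∈ A | x - a ∈ B} ×ˢ {a ∈ A | x - a ∈ B} |
          (#{bb ∈ B ×ˢ B | bb.1 - bb.2 = p.1 - p.2} : ℝ) < t} =
        {q ∈ Hbad | x - q.1 ∈ B ∧ x - q.2 ∈ B} := by
    intro x
    ext ⟨a, a'⟩
    simp only [mem_filter, mem_product, hHbad]
    tauto
  have hswap : ∑ x ∈ A + B, (#{q ∈ Hbad | x - q.1 ∈ B ∧ x - q.2 ∈ B} : ℝ)
      = ∑ q ∈ Hbad, (#{x ∈ A + B | x - q.1 ∈ B ∧ x - q.2 ∈ B} : ℝ) := by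
    simp only [card_filter, Nat.cast_sum, Nat.cast_ite, Nat.cast_one, Nat.cast_zero]
    rw [sum_comm]
  calc ∑ x ∈ A + B, (#{ab ∈ A ×ˢ B | ab.1 + ab.2 = x} : ℝ) *
        #{p ∈ {a ∈ A | x - a ∈ B} ×ˢ {a ∈ A | x - a ∈ B} |
          (#{bb ∈ B ×ˢ B | bb.1 - bb.2 = p.1 - p.2} : ℝ) < t}
      ≤ ∑ x ∈ A + B, (#B : ℝ) *
        #{p ∈ {a ∈ A | x - a ∈ B} ×ˢ {a ∈ A | x - a ∈ B} |
          (#{bb ∈ B ×ˢ B | bb.1 - bb.2 = p.1 - p.2} : ℝ) < t} := by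
        gcongr with x hx
        exact_mod_cast bsg_rep_le_card_right A B x
    _ = #B * ∑ q ∈ Hbad, (#{x ∈ A + B | x - q.1 ∈ B ∧ x - q.2 ∈ B} : ℝ) := by
        rw [← hswap, mul_sum]
        exact sum_congr rfl fun x _ => by rw [hset x]
    _ ≤ #B * ∑ q ∈ Hbad, (#{bb ∈ B ×ˢ B | bb.1 - bb.2 = q.1 - q.2} : ℝ) := by
        gcongr with q hq
        exact_mod_cast bsg_card_common_le A B q.1 q.2
    _ ≤ #B * ∑ _q ∈ Hbad, t := by
        gcongr with q hq
        exact ((mem_filter.1 hq).2).le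
    _ = #B * (#Hbad * t) := by rw [sum_const, nsmul_eq_mul]
    _ ≤ #B * (#A ^ 2 * t) := by
        gcongr
        calc (#Hbad : ℝ) ≤ #(A ×ˢ A) := by exact_mod_cast card_filter_le _ _
          _ = #A ^ 2 := by rw [card_product, sq, Nat.cast_mul]

/-! #### Step 3. Averaging: a slice `X = A ∩ (x - B)` that is large and has few unpopular pairs. -/

/-- **Path of length 2 lemma, additive form** (dependent random choice): if `E(A, B) ≥ |A|²|B|/K`
then for some `x ∈ A + B` the slice `X = {a ∈ A : x - a ∈ B}` has `|X| ≥ |A|/(2K)` and at most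
`|X|²/8` pairs `(a, a') ∈ X × X` with fewer than `|A|/(16K²)` representations `a - a' = b - b'` in
`B`. Obtained by averaging `r(x) · (E²/(16|A|²|B|²) + bad(x)) ≤ r(x) · r(x)²/8` over `x` with the
two previous lemmas (threshold `t = E²/(16|A|³|B|²) ≥ |A|/(16K²)`).
[cite: Zhao2023, Lemma 7.13.10 (path of length 2 lemma); Gowers' additive form] -/
theorem bsg_exists_good_slice (A B : Finset G) (hA : A.Nonempty) (hB : B.Nonempty) {K : ℝ}
    (hK : 0 < K) (hEK : (#A : ℝ) ^ 2 * #B / K ≤ E[A, B]) :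
    ∃ x ∈ A + B,
      (#A : ℝ) / (2 * K) ≤ #{a ∈ A | x - a ∈ B} ∧
      (#{p ∈ {a ∈ A | x - a ∈ B} ×ˢ {a ∈ A | x - a ∈ B} |
          (#{bb ∈ B ×ˢ B | bb.1 - bb.2 = p.1 - p.2} : ℝ) < #A / (16 * K ^ 2)} : ℝ)
        ≤ (#{a ∈ A | x - a ∈ B} : ℝ) ^ 2 / 8 := by
  have hA0 : (0 : ℝ) < #A := by exact_mod_cast hA.card_pos
  have hB0 : (0 : ℝ) < #B := by exact_mod_cast hB.card_pos
  have hA0' : (#A : ℝ) ≠ 0 := hA0.ne'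
  have hB0' : (#B : ℝ) ≠ 0 := hB0.ne'
  have hK' : K ≠ 0 := hK.ne'
  set E : ℝ := (E[A, B] : ℝ) with hE
  set r : G → ℝ := fun x => (#{ab ∈ A ×ˢ B | ab.1 + ab.2 = x} : ℝ) with hr
  set t : ℝ := E ^ 2 / (16 * #A ^ 3 * #B ^ 2) with ht
  set bad : G → ℝ := fun x => (#{p ∈ {a ∈ A | x - a ∈ B} ×ˢ {a ∈ A | x - a ∈ B} |
      (#{bb ∈ B ×ˢ B | bb.1 - bb.2 = p.1 - p.2} : ℝ) < t} : ℝ) with hbad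
  have hEpos : 0 < E := lt_of_lt_of_le (by positivity) hEK
  have ht0 : 0 ≤ t := by positivity
  have hslice : ∀ x, (#{a ∈ A | x - a ∈ B} : ℝ) = r x := fun x => by
    simp only [hr, bsg_card_rep_eq]
  have h1 : ∑ x ∈ A + B, r x = #A * #B := by
    simp only [hr]; exact_mod_cast bsg_sum_rep A B
  have h3 : E ^ 2 ≤ #A * #B * ∑ x ∈ A + B, r x * r x ^ 2 := by
    simpa only [hr] using bsg_energy_sq_le A B
  have h4 : ∑ x ∈ A + B, r x * bad x ≤ #B * (#A ^ 2 * t) := by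
    simp only [hr, hbad]; exact bsg_sum_bad_le A B ht0
  have key : ∑ x ∈ A + B, r x * (E ^ 2 / (16 * #A ^ 2 * #B ^ 2) + bad x)
      ≤ ∑ x ∈ A + B, r x * (r x ^ 2 / 8) := by
    have lhs : ∑ x ∈ A + B, r x * (E ^ 2 / (16 * #A ^ 2 * #B ^ 2) + bad x)
        = E ^ 2 / (16 * #A ^ 2 * #B ^ 2) * (#A * #B) + ∑ x ∈ A + B, r x * bad x := by
      rw [← h1, mul_sum, ← sum_add_distrib]
      exact sum_congr rfl fun x _ => by ring
    have rhs : ∑ x ∈ A + B, r x * (r x ^ 2 / 8) = (∑ x ∈ A + B, r x * r x ^ 2) / 8 := by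
      rw [div_eq_mul_inv, sum_mul]; exact sum_congr rfl fun x _ => by ring
    rw [lhs, rhs]
    have e1 : E ^ 2 / (16 * #A ^ 2 * #B ^ 2) * (#A * #B) = E ^ 2 / (16 * (#A * #B)) := by
      field_simp
    have e2 : (#B : ℝ) * (#A ^ 2 * t) = E ^ 2 / (16 * (#A * #B)) := by
      rw [ht]; field_simp
    have e3 : E ^ 2 / (#A * #B) ≤ ∑ x ∈ A + B, r x * r x ^ 2 := by
      rw [div_le_iff₀ (by positivity)]; linarith [h3]
    calc E ^ 2 / (16 * #A ^ 2 * #B ^ 2) * (#A * #B) + ∑ x ∈ A + B, r x * bad x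
        ≤ E ^ 2 / (16 * (#A * #B)) + E ^ 2 / (16 * (#A * #B)) := by
          rw [e1, ← e2]; linarith [h4]
      _ = E ^ 2 / (#A * #B) / 8 := by field_simp; ring
      _ ≤ (∑ x ∈ A + B, r x * r x ^ 2) / 8 := by gcongr
  obtain ⟨x, hx, hle⟩ := exists_le_of_sum_le (hA.add hB) key
  have hrpos : 0 < r x := by
    obtain ⟨a, ha, b, hb, rfl⟩ := mem_add.1 hx
    simp only [hr]
    exact_mod_cast card_pos.2 ⟨(a, b), by simp [ha, hb]⟩
  have hle' : E ^ 2 / (16 * #A ^ 2 * #B ^ 2) + bad x ≤ r x ^ 2 / 8 :=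
    le_of_mul_le_mul_left hle hrpos
  have hbad0 : 0 ≤ bad x := by simp only [hbad]; positivity
  have hM0 : 0 ≤ E ^ 2 / (16 * #A ^ 2 * #B ^ 2) := by positivity
  have hEK2 : ((#A : ℝ) ^ 2 * #B / K) ^ 2 ≤ E ^ 2 := by gcongr
  refine ⟨x, hx, ?_, ?_⟩
  · rw [hslice]
    have hsq : (#A / (2 * K)) ^ 2 ≤ r x ^ 2 := by
      have i1 : ((#A : ℝ) / (2 * K)) ^ 2 ≤ 8 * (((#A : ℝ) ^ 2 * #B / K) ^ 2 / (16 * #A ^ 2 * #B ^ 2)) := by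
        have : 8 * (((#A : ℝ) ^ 2 * #B / K) ^ 2 / (16 * #A ^ 2 * #B ^ 2)) = 2 * (#A / (2 * K)) ^ 2 := by
          field_simp; ring
        rw [this]
        nlinarith [sq_nonneg ((#A : ℝ) / (2 * K))]
      have i2 : 8 * (((#A : ℝ) ^ 2 * #B / K) ^ 2 / (16 * #A ^ 2 * #B ^ 2)) ≤
          8 * (E ^ 2 / (16 * #A ^ 2 * #B ^ 2)) := by gcongr
      linarith
    exact (pow_le_pow_iff_left₀ (by positivity) hrpos.le two_ne_zero).1 hsq
  · rw [hslice]
    have htt : (#A : ℝ) / (16 * K ^ 2) ≤ t := by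
      rw [ht]
      calc (#A : ℝ) / (16 * K ^ 2) = ((#A : ℝ) ^ 2 * #B / K) ^ 2 / (16 * #A ^ 3 * #B ^ 2) := by
            field_simp
        _ ≤ E ^ 2 / (16 * #A ^ 3 * #B ^ 2) := by gcongr
    calc (#{p ∈ {a ∈ A | x - a ∈ B} ×ˢ {a ∈ A | x - a ∈ B} |
          (#{bb ∈ B ×ˢ B | bb.1 - bb.2 = p.1 - p.2} : ℝ) < #A / (16 * K ^ 2)} : ℝ) ≤ bad x := by
          simp only [hbad]
          exact_mod_cast card_le_card fun p hp => by
            simp only [mem_filter] at hp ⊢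
            exact ⟨hp.1, hp.2.trans_le htt⟩
      _ ≤ r x ^ 2 / 8 := by linarith

/-! #### Step 4. The graph step: popular vertices and paths of length two. -/

/-- **Popular vertices and the difference set.** Let `H ⊆ X × X` be the pairs `(a, a')` with
`d(a - a') ≥ t₀` and suppose its complement has at most `|X|²/8` pairs. Let `A'` be the vertices of
`H`-degree `≥ (3/4)|X|`. Then `|A'| ≥ |X|/8` (degree counting), two vertices of `A'` have `≥ |X|/2`
common `H`-neighbours `c`, and each such `c` yields `d(a - c) d(b - c) ≥ t₀²` quadruples
`(b₁, b₂, b₃, b₄) ∈ B⁴` with `(b₁ - b₂) - (b₃ - b₄) = a - b`; summing over `A' - A'` (disjoint fibres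
in `B⁴`) gives `|A' - A'| · (|X|/2) t₀² ≤ |B|⁴`.
[cite: Zhao2023, §7.13, proofs of Lemma 7.13.11 and Theorem 7.13.9 (friendly pairs, common neighbours, counting representations); Gowers' additive form] -/
theorem bsg_graph_step (B X : Finset G) {t₀ : ℝ} (ht₀ : 0 ≤ t₀) (hX : X.Nonempty)
    (hbad : (#{p ∈ X ×ˢ X | (#{bb ∈ B ×ˢ B | bb.1 - bb.2 = p.1 - p.2} : ℝ) < t₀} : ℝ)
      ≤ (#X : ℝ) ^ 2 / 8) :
    ∃ A' ⊆ X, (#X : ℝ) / 8 ≤ #A' ∧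
      (#(A' - A') : ℝ) * ((#X / 2) * t₀ ^ 2) ≤ (#B : ℝ) ^ 4 := by
  set d : G → ℝ := fun y => (#{bb ∈ B ×ˢ B | bb.1 - bb.2 = y} : ℝ) with hd
  set H : Finset (G × G) := {p ∈ X ×ˢ X | t₀ ≤ d (p.1 - p.2)} with hH
  set N : G → Finset G := fun a => {c ∈ X | (a, c) ∈ H} with hN
  set A' : Finset G := {a ∈ X | (3 / 4 : ℝ) * #X ≤ #(N a)} with hA'
  have hXpos : (0 : ℝ) < #X := by exact_mod_cast hX.card_pos
  -- `#H ≥ (7/8) #X²`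
  have hHcard : (7 / 8 : ℝ) * #X ^ 2 ≤ #H := by
    have hsplit := card_filter_add_card_filter_not (s := X ×ˢ X)
      (fun p : G × G => t₀ ≤ d (p.1 - p.2))
    rw [card_product] at hsplit
    have hsplit' : (#H : ℝ) + #{p ∈ X ×ˢ X | ¬ t₀ ≤ d (p.1 - p.2)} = #X * #X := by
      rw [hH]; exact_mod_cast hsplit
    have hbad' : (#{p ∈ X ×ˢ X | ¬ t₀ ≤ d (p.1 - p.2)} : ℝ) ≤ #X ^ 2 / 8 := by
      simpa only [not_le, hd] using hbad
    nlinarith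
  -- `#H = ∑_{a ∈ X} deg a`
  have hHsum : (#H : ℝ) = ∑ a ∈ X, (#(N a) : ℝ) := by
    have hfib := card_eq_sum_card_fiberwise (f := Prod.fst) (s := H) (t := X) fun p hp => by
      simp only [mem_coe, hH, mem_filter, mem_product] at hp
      exact mem_coe.2 hp.1.1
    rw [hfib]
    push_cast
    refine sum_congr rfl fun a _ => ?_
    simp only [hN]
    congr 1
    refine card_nbij' Prod.snd (fun c => (a, c)) ?_ ?_ ?_ ?_
    · rintro ⟨a₀, c⟩ hp
      simp only [mem_coe, mem_filter] at hp ⊢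
      obtain ⟨hpH, rfl⟩ := hp
      have hXX := (mem_filter.1 hpH).1
      exact ⟨(mem_product.1 hXX).2, hpH⟩
    · intro c hc
      simp only [mem_coe, mem_filter] at hc ⊢
      exact ⟨hc.2, by simp⟩
    · rintro ⟨a₀, c⟩ hp
      simp only [mem_coe, mem_filter] at hp
      obtain ⟨-, rfl⟩ := hp
      rfl
    · intro c _
      rfl
  -- `#A' #X ≥ #X² / 8`
  have hA'card : (#X : ℝ) ^ 2 / 8 ≤ #A' * #X := by
    have s1 : ∑ a ∈ X with (3 / 4 : ℝ) * #X ≤ #(N a), (#(N a) : ℝ) ≤ #A' * #X := by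
      calc ∑ a ∈ X with (3 / 4 : ℝ) * #X ≤ #(N a), (#(N a) : ℝ)
          ≤ ∑ a ∈ X with (3 / 4 : ℝ) * #X ≤ #(N a), (#X : ℝ) := by
            refine sum_le_sum fun a _ => ?_
            exact_mod_cast card_filter_le _ _
        _ = #A' * #X := by rw [sum_const, nsmul_eq_mul, hA']
    have s2 : ∑ a ∈ X with ¬ (3 / 4 : ℝ) * #X ≤ #(N a), (#(N a) : ℝ) ≤ (3 / 4 : ℝ) * #X * #X := by
      calc ∑ a ∈ X with ¬ (3 / 4 : ℝ) * #X ≤ #(N a), (#(N a) : ℝ)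
          ≤ ∑ a ∈ X with ¬ (3 / 4 : ℝ) * #X ≤ #(N a), (3 / 4 : ℝ) * #X := by
            gcongr with a ha
            exact (not_le.1 (mem_filter.1 ha).2).le
        _ = #{a ∈ X | ¬ (3 / 4 : ℝ) * #X ≤ #(N a)} * ((3 / 4 : ℝ) * #X) := by
            rw [sum_const, nsmul_eq_mul]
        _ ≤ #X * ((3 / 4 : ℝ) * #X) := by
            refine mul_le_mul_of_nonneg_right ?_ (by positivity)
            exact_mod_cast card_filter_le _ _
        _ = (3 / 4 : ℝ) * #X * #X := by ring
    have hsum : ∑ a ∈ X, (#(N a) : ℝ) ≤ (3 / 4 : ℝ) * #X * #X + #A' * #X := by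
      rw [← sum_filter_add_sum_filter_not X (fun a => (3 / 4 : ℝ) * #X ≤ #(N a))]
      linarith
    nlinarith [hHcard, hHsum]
  have hA'ge : (#X : ℝ) / 8 ≤ #A' := by
    refine le_of_mul_le_mul_right ?_ hXpos
    calc (#X : ℝ) / 8 * #X = #X ^ 2 / 8 := by ring
      _ ≤ #A' * #X := hA'card
  refine ⟨A', filter_subset _ _, hA'ge, ?_⟩
  -- common neighbours of two popular vertices
  have hcommon : ∀ a ∈ A', ∀ b ∈ A',
      (#X : ℝ) / 2 ≤ #{c ∈ X | (a, c) ∈ H ∧ (b, c) ∈ H} := by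
    intro a ha b hb
    have ha' := (mem_filter.1 ha).2
    have hb' := (mem_filter.1 hb).2
    simp only [hN] at ha' hb'
    have hunion : (#({c ∈ X | (a, c) ∈ H} ∪ {c ∈ X | (b, c) ∈ H}) : ℝ) ≤ #X := by
      exact_mod_cast card_le_card (union_subset (filter_subset _ _) (filter_subset _ _))
    have hie := card_union_add_card_inter {c ∈ X | (a, c) ∈ H} {c ∈ X | (b, c) ∈ H}
    rw [← filter_and] at hie
    have hie' : (#({c ∈ X | (a, c) ∈ H} ∪ {c ∈ X | (b, c) ∈ H}) : ℝ) +
        #{c ∈ X | (a, c) ∈ H ∧ (b, c) ∈ H} = #{c ∈ X | (a, c) ∈ H} + #{c ∈ X | (b, c) ∈ H} := by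
      exact_mod_cast hie
    linarith
  -- many quadruples for each difference of popular vertices
  have hquad : ∀ a ∈ A', ∀ b ∈ A',
      (#X : ℝ) / 2 * t₀ ^ 2 ≤
        #{q ∈ (B ×ˢ B) ×ˢ (B ×ˢ B) | (q.1.1 - q.1.2) - (q.2.1 - q.2.2) = a - b} := by
    intro a ha b hb
    set C : Finset G := {c ∈ X | (a, c) ∈ H ∧ (b, c) ∈ H} with hC
    have hinj : #(C.sigma fun c =>
          {p ∈ B ×ˢ B | p.1 - p.2 = a - c} ×ˢ {p ∈ B ×ˢ B | p.1 - p.2 = b - c})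
        ≤ #{q ∈ (B ×ˢ B) ×ˢ (B ×ˢ B) | (q.1.1 - q.1.2) - (q.2.1 - q.2.2) = a - b} := by
      refine card_le_card_of_injOn (fun s => s.2) ?_ ?_
      · rintro ⟨c, p, p'⟩ h
        simp only [mem_coe, mem_sigma, mem_product, mem_filter] at h ⊢
        refine ⟨⟨h.2.1.1, h.2.2.1⟩, ?_⟩
        rw [h.2.1.2, h.2.2.2]
        abel
      · rintro ⟨c₁, q₁⟩ h₁ ⟨c₂, q₂⟩ h₂ (heq : q₁ = q₂)
        simp only [mem_coe, mem_sigma, mem_product, mem_filter] at h₁ h₂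
        subst heq
        have hc : c₁ = c₂ := sub_right_injective (h₁.2.1.2.symm.trans h₂.2.1.2)
        subst hc
        rfl
    have hcount : (#(C.sigma fun c =>
          {p ∈ B ×ˢ B | p.1 - p.2 = a - c} ×ˢ {p ∈ B ×ˢ B | p.1 - p.2 = b - c}) : ℝ)
        = ∑ c ∈ C, d (a - c) * d (b - c) := by
      rw [card_sigma]
      push_cast
      refine sum_congr rfl fun c _ => ?_
      rw [card_product, Nat.cast_mul]
    calc (#X : ℝ) / 2 * t₀ ^ 2 ≤ #C * (t₀ * t₀) := by
          rw [sq]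
          gcongr
          exact hcommon a ha b hb
      _ = ∑ _c ∈ C, t₀ * t₀ := by rw [sum_const, nsmul_eq_mul]
      _ ≤ ∑ c ∈ C, d (a - c) * d (b - c) := by
          refine sum_le_sum fun c hc => ?_
          obtain ⟨-, hac, hbc⟩ := mem_filter.1 hc
          have hac' : t₀ ≤ d (a - c) := (mem_filter.1 hac).2
          have hbc' : t₀ ≤ d (b - c) := (mem_filter.1 hbc).2
          exact mul_le_mul hac' hbc' ht₀ (ht₀.trans hac')
      _ = _ := hcount.symm
      _ ≤ _ := by exact_mod_cast hinj
  -- sum over the difference set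
  have hfib : ∑ y ∈ A' - A',
      (#{q ∈ (B ×ˢ B) ×ˢ (B ×ˢ B) | (q.1.1 - q.1.2) - (q.2.1 - q.2.2) = y} : ℝ)
        ≤ (#B : ℝ) ^ 4 := by
    have hf := sum_card_fiberwise_eq_card_filter ((B ×ˢ B) ×ˢ (B ×ˢ B)) (A' - A')
      (fun q => (q.1.1 - q.1.2) - (q.2.1 - q.2.2))
    calc ∑ y ∈ A' - A',
        (#{q ∈ (B ×ˢ B) ×ˢ (B ×ˢ B) | (q.1.1 - q.1.2) - (q.2.1 - q.2.2) = y} : ℝ)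
        = #{q ∈ (B ×ˢ B) ×ˢ (B ×ˢ B) | (q.1.1 - q.1.2) - (q.2.1 - q.2.2) ∈ A' - A'} := by
          exact_mod_cast hf
      _ ≤ #((B ×ˢ B) ×ˢ (B ×ˢ B)) := by exact_mod_cast card_filter_le _ _
      _ = (#B : ℝ) ^ 4 := by rw [card_product, card_product]; push_cast; ring
  calc (#(A' - A') : ℝ) * (#X / 2 * t₀ ^ 2)
      = ∑ _y ∈ A' - A', (#X : ℝ) / 2 * t₀ ^ 2 := by rw [sum_const, nsmul_eq_mul]
    _ ≤ ∑ y ∈ A' - A',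
        (#{q ∈ (B ×ˢ B) ×ˢ (B ×ˢ B) | (q.1.1 - q.1.2) - (q.2.1 - q.2.2) = y} : ℝ) := by
        refine sum_le_sum fun y hy => ?_
        obtain ⟨a, ha, b, hb, rfl⟩ := mem_sub.1 hy
        exact hquad a ha b hb
    _ ≤ _ := hfib

/-! #### Step 5. Assembly: the difference-set form for one set, then Zhao's Theorem 7.13.6. -/

/-- **Balog–Szemerédi–Gowers, difference-set form with explicit constants**: if `A` is a finite
non-empty subset of an abelian group with `E(A) ≥ |A|³/K`, `K ≥ 1`, then some `A' ⊆ A` has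
`|A| ≤ 16K |A'|` and `|A' - A'| ≤ 2^14 K^6 |A'|` (the constants of `add-combi`'s `BSG_self'`).
[cite: Zhao2023, Theorem 7.13.6 (with `A' - A'`; Gowers 2001)] -/
theorem bsg_self_sub (A : Finset G) (hA : A.Nonempty) {K : ℝ} (hK : 1 ≤ K)
    (hE : (#A : ℝ) ^ 3 / K ≤ E[A]) :
    ∃ A' ⊆ A, (#A : ℝ) ≤ 16 * K * #A' ∧ (#(A' - A') : ℝ) ≤ 2 ^ 14 * K ^ 6 * #A' := by
  have hK0 : 0 < K := by linarith
  have hApos : (0 : ℝ) < #A := by exact_mod_cast hA.card_pos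
  obtain ⟨x, -, hXge, hbad⟩ := bsg_exists_good_slice A A hA hA hK0
    (by rw [show (#A : ℝ) ^ 2 * #A = (#A : ℝ) ^ 3 by ring]; exact hE)
  set X : Finset G := {a ∈ A | x - a ∈ A} with hXdef
  have hXA : X ⊆ A := filter_subset _ _
  have hXpos : (0 : ℝ) < #X := lt_of_lt_of_le (by positivity) hXge
  have hXne : X.Nonempty := by
    rw [← card_pos]; exact_mod_cast hXpos
  obtain ⟨A', hA'X, hA'ge, hdiff⟩ :=
    bsg_graph_step A X (t₀ := #A / (16 * K ^ 2)) (by positivity) hXne hbad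
  have hsize : (#A : ℝ) ≤ 16 * K * #A' := by
    have h8 : (#X : ℝ) ≤ 8 * #A' := by linarith
    calc (#A : ℝ) ≤ 2 * K * #X := by rw [div_le_iff₀ (by positivity)] at hXge; linarith
      _ ≤ 2 * K * (8 * #A') := by gcongr
      _ = 16 * K * #A' := by ring
  refine ⟨A', hA'X.trans hXA, hsize, ?_⟩
  have hlow : (#A : ℝ) ^ 3 / (2 ^ 10 * K ^ 5) ≤ #X / 2 * (#A / (16 * K ^ 2)) ^ 2 := by
    calc (#A : ℝ) ^ 3 / (2 ^ 10 * K ^ 5) = (#A / (2 * K)) / 2 * (#A / (16 * K ^ 2)) ^ 2 := by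
          field_simp; ring
      _ ≤ #X / 2 * (#A / (16 * K ^ 2)) ^ 2 := by gcongr
  have h1 : (#(A' - A') : ℝ) * (#A ^ 3 / (2 ^ 10 * K ^ 5)) ≤ (#A : ℝ) ^ 4 :=
    le_trans (mul_le_mul_of_nonneg_left hlow (by positivity)) hdiff
  have h2 : (#(A' - A') : ℝ) ≤ 2 ^ 10 * K ^ 5 * #A := by
    rw [mul_div_assoc', div_le_iff₀ (by positivity)] at h1
    refine le_of_mul_le_mul_right ?_ (by positivity : (0 : ℝ) < #A ^ 3)
    calc (#(A' - A') : ℝ) * #A ^ 3 ≤ #A ^ 4 * (2 ^ 10 * K ^ 5) := h1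
      _ = 2 ^ 10 * K ^ 5 * #A * #A ^ 3 := by ring
  calc (#(A' - A') : ℝ) ≤ 2 ^ 10 * K ^ 5 * #A := h2
    _ ≤ 2 ^ 10 * K ^ 5 * (16 * K * #A') := by gcongr
    _ = 2 ^ 14 * K ^ 6 * #A' := by ring

/-! #### Step 6. Tao–Vu Lemma 2.30: large energy gives a dense graph of popular sums. -/

/-- `r(x) ≤ |A|`: a representation `x = a + b` is determined by `a` (companion of
`bsg_rep_le_card_right`). [folklore] -/
theorem bsg_rep_le_card_left (A B : Finset G) (x : G) :
    #{ab ∈ A ×ˢ B | ab.1 + ab.2 = x} ≤ #A := by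
  refine card_le_card_of_injOn Prod.fst (fun ab hab => ?_) ?_
  · simp only [mem_coe, mem_filter, mem_product] at hab
    exact hab.1.1
  · rintro ⟨a₁, b₁⟩ h₁ ⟨a₂, b₂⟩ h₂ (h : a₁ = a₂)
    simp only [mem_coe, mem_filter, mem_product] at h₁ h₂
    subst h
    have : b₁ = b₂ := add_left_cancel (h₁.2.trans h₂.2.symm)
    rw [this]

/-- **Discharge of `energy_partialSumset`** (Tao–Vu, Lemma 2.30, second assertion, as printed): if
`E(A, B) ≥ |A|^{3/2}|B|^{3/2}/K` (`K ≥ 1`, `A, B` non-empty) then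
`G := {(a, b) ∈ A × B : a + b ∈ S}`, where `S` is the set of popular sums
`{x : r(x) ≥ |A|^{1/2}|B|^{1/2}/(2K)}`, has `|G| ≥ |A||B|/(2K)` and `A +_G B ⊆ S`,
`|S| ≤ 2K|A|^{1/2}|B|^{1/2}`. The printed proof: unpopular sums carry energy
`< |A|^{3/2}|B|^{3/2}/(2K)`, so `∑_{x ∈ S} r(x)² ≥ |A|^{3/2}|B|^{3/2}/(2K)`, and
`r(x) ≤ min(|A|, |B|) ≤ |A|^{1/2}|B|^{1/2}` gives `|G| = ∑_{x ∈ S} r(x) ≥ |A||B|/(2K)`; finally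
`|S| · |A|^{1/2}|B|^{1/2}/(2K) ≤ ∑_{x ∈ S} r(x) ≤ |A||B|`. (First landed as p50060 by the
`energy_partialSumset` seat; re-landed here unchanged in statement because p50268 replaced this
file.) [cite: TaoVu2006, Lemma 2.30 (second assertion), pp. 86–87] -/
theorem energy_partialSumset_holds : energy_partialSumset := by
  intro Z _ _ A B K hA hB hK hE
  have hA0 : (0 : ℝ) < #A := by exact_mod_cast hA.card_pos
  have hB0 : (0 : ℝ) < #B := by exact_mod_cast hB.card_pos
  have hK0 : 0 < K := by linarith
  have hK' : K ≠ 0 := hK0.ne'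
  set N : ℝ := Real.sqrt ((#A : ℝ) * #B) with hN
  have hN0 : 0 < N := Real.sqrt_pos.2 (by positivity)
  have hN' : N ≠ 0 := hN0.ne'
  have hN2 : N ^ 2 = (#A : ℝ) * #B := Real.sq_sqrt (by positivity)
  set θ : ℝ := N / (2 * K) with hθ
  have hθ0 : 0 < θ := by positivity
  set r : Z → ℝ := fun x => (#{ab ∈ A ×ˢ B | ab.1 + ab.2 = x} : ℝ) with hr
  have hr0 : ∀ x, 0 ≤ r x := fun x => by simp only [hr]; positivity
  set S : Finset Z := {x ∈ A + B | θ ≤ r x} with hS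
  set G' : Finset (Z × Z) := {ab ∈ A ×ˢ B | ab.1 + ab.2 ∈ S} with hG'
  have hS_sub : S ⊆ A + B := filter_subset _ _
  have hsumr : ∑ x ∈ A + B, r x = #A * #B := by
    simp only [hr]; exact_mod_cast bsg_sum_rep A B
  have hSr : ∑ x ∈ S, r x ≤ #A * #B := by
    rw [← hsumr]
    exact sum_le_sum_of_subset_of_nonneg hS_sub fun x _ _ => hr0 x
  refine ⟨G', filter_subset _ _, ?_, ?_⟩
  · -- `|G| = ∑_{x ∈ S} r(x) ≥ ∑_{x ∈ S} r(x)² / N ≥ N² / (2K)`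
    have hGsum : (#G' : ℝ) = ∑ x ∈ S, r x := by
      have hf := sum_card_fiberwise_eq_card_filter (A ×ˢ B) S (fun ab : Z × Z => ab.1 + ab.2)
      simp only [hG', hr]
      exact_mod_cast hf.symm
    have hEsum : (E[A, B] : ℝ) = ∑ x ∈ A + B, r x ^ 2 := by
      rw [addEnergy_eq_sum_sq']
      push_cast
      simp only [hr]
    have hrN : ∀ x, r x ≤ N := fun x => by
      have h1 : r x ≤ #A := by simp only [hr]; exact_mod_cast bsg_rep_le_card_left A B x
      have h2 : r x ≤ #B := by simp only [hr]; exact_mod_cast bsg_rep_le_card_right A B x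
      calc r x = Real.sqrt (r x ^ 2) := (Real.sqrt_sq (hr0 x)).symm
        _ ≤ Real.sqrt (#A * #B) :=
            Real.sqrt_le_sqrt (by rw [sq]; exact mul_le_mul h1 h2 (hr0 x) hA0.le)
    have hsplit : ∑ x ∈ A + B, r x ^ 2 =
        ∑ x ∈ S, r x ^ 2 + ∑ x ∈ (A + B).filter (fun x => ¬ θ ≤ r x), r x ^ 2 := by
      rw [hS, sum_filter_add_sum_filter_not]
    have hunpop : ∑ x ∈ (A + B).filter (fun x => ¬ θ ≤ r x), r x ^ 2 ≤ θ * (#A * #B) := by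
      calc ∑ x ∈ (A + B).filter (fun x => ¬ θ ≤ r x), r x ^ 2
          ≤ ∑ x ∈ (A + B).filter (fun x => ¬ θ ≤ r x), θ * r x := by
            refine sum_le_sum fun x hx => ?_
            have hlt : r x < θ := not_le.1 (mem_filter.1 hx).2
            rw [sq]
            exact mul_le_mul_of_nonneg_right hlt.le (hr0 x)
        _ = θ * ∑ x ∈ (A + B).filter (fun x => ¬ θ ≤ r x), r x := by rw [mul_sum]
        _ ≤ θ * ∑ x ∈ A + B, r x := by
            refine mul_le_mul_of_nonneg_left ?_ hθ0.le
            exact sum_le_sum_of_subset_of_nonneg (filter_subset _ _) fun x _ _ => hr0 x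
        _ = θ * (#A * #B) := by rw [hsumr]
    have hEN : N ^ 3 / K ≤ ∑ x ∈ A + B, r x ^ 2 := by rw [← hEsum]; exact hE
    have hθN : θ * (#A * #B) = N ^ 3 / (2 * K) := by
      rw [hθ, ← hN2]; field_simp
    have hpop : N ^ 3 / (2 * K) ≤ ∑ x ∈ S, r x ^ 2 := by
      have : N ^ 3 / K = N ^ 3 / (2 * K) + N ^ 3 / (2 * K) := by field_simp; ring
      linarith [hsplit, hunpop]
    have hSN : ∑ x ∈ S, r x ^ 2 ≤ N * ∑ x ∈ S, r x := by
      rw [mul_sum]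
      refine sum_le_sum fun x _ => ?_
      rw [sq]
      exact mul_le_mul_of_nonneg_right (hrN x) (hr0 x)
    rw [hGsum, ← hN2]
    refine le_of_mul_le_mul_right ?_ hN0
    calc N ^ 2 / (2 * K) * N = N ^ 3 / (2 * K) := by ring
      _ ≤ ∑ x ∈ S, r x ^ 2 := hpop
      _ ≤ N * ∑ x ∈ S, r x := hSN
      _ = (∑ x ∈ S, r x) * N := mul_comm _ _
  · -- `A +_G B ⊆ S` and `|S| θ ≤ ∑_{x ∈ S} r(x) ≤ |A||B| = N²`
    have hsub : partialSumset G' ⊆ S := by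
      intro x hx
      simp only [partialSumset, mem_image] at hx
      obtain ⟨ab, hab, rfl⟩ := hx
      exact (mem_filter.1 hab).2
    have hScard : (#S : ℝ) * θ ≤ #A * #B := by
      calc (#S : ℝ) * θ = ∑ _x ∈ S, θ := by rw [sum_const, nsmul_eq_mul]
        _ ≤ ∑ x ∈ S, r x := sum_le_sum fun x hx => (mem_filter.1 hx).2
        _ ≤ #A * #B := hSr
    calc (#(partialSumset G') : ℝ) ≤ #S := by exact_mod_cast card_le_card hsub
      _ ≤ #A * #B / θ := by rw [le_div_iff₀ hθ0]; exact hScard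
      _ = 2 * K * N := by rw [← hN2, hθ]; field_simp

end BSGProof

/-- **Discharge of `Zhao2023_thm7136`** (Balog–Szemerédi–Gowers, energy form, Zhao 2023 Thm 7.13.6)
with the absolute constant `C = 2 ^ 28`: `|A| ≤ 16 K |A'|` and `|A' + A'| ≤ 2^28 K^12 |A'|`.
The proof is Gowers' argument (popular differences and paths of length two, giving
`|A' - A'| ≤ 2^14 K^6 |A'|`), followed by the Ruzsa triangle inequality
`|A' + A'| |A'| ≤ |A' - A'|²` (Mathlib). [cite: Zhao2023, Theorem 7.13.6] -/
theorem Zhao2023_thm7136_holds : Zhao2023_thm7136 := by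
  refine ⟨2 ^ 28, by norm_num, ?_⟩
  intro Z _ _ A K hA hK hE
  have hK0 : 0 < K := by linarith
  obtain ⟨A', hA'A, hsize, hdiff⟩ := bsg_self_sub A hA hK hE
  have hApos : (0 : ℝ) < #A := by exact_mod_cast hA.card_pos
  have hA'pos : (0 : ℝ) < #A' := by
    by_contra h
    have : (#A' : ℝ) = 0 := le_antisymm (not_lt.1 h) (by positivity)
    rw [this, mul_zero] at hsize
    linarith
  have hRT : (#(A' + A') : ℝ) * #A' ≤ #(A' - A') * #(A' - A') := by
    exact_mod_cast ruzsa_triangle_inequality_add_sub_sub A' A' A'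
  have hsum : (#(A' + A') : ℝ) ≤ 2 ^ 28 * K ^ 12 * #A' := by
    refine le_of_mul_le_mul_right ?_ hA'pos
    calc (#(A' + A') : ℝ) * #A' ≤ #(A' - A') * #(A' - A') := hRT
      _ ≤ (2 ^ 14 * K ^ 6 * #A') * (2 ^ 14 * K ^ 6 * #A') := by gcongr
      _ = 2 ^ 28 * K ^ 12 * #A' * #A' := by ring
  have hK1 : K ≤ K ^ (2 ^ 28 : ℝ) := by
    calc K = K ^ (1 : ℝ) := (Real.rpow_one K).symm
      _ ≤ K ^ (2 ^ 28 : ℝ) := Real.rpow_le_rpow_of_exponent_le hK (by norm_num)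
  have hK12 : K ^ 12 ≤ K ^ (2 ^ 28 : ℝ) := by
    calc K ^ 12 = K ^ ((12 : ℕ) : ℝ) := (Real.rpow_natCast K 12).symm
      _ ≤ K ^ (2 ^ 28 : ℝ) := Real.rpow_le_rpow_of_exponent_le hK (by norm_num)
  refine ⟨A', hA'A, ?_, ?_⟩
  · calc (#A : ℝ) ≤ 16 * K * #A' := hsize
      _ ≤ 2 ^ 28 * K ^ (2 ^ 28 : ℝ) * #A' := by
          apply mul_le_mul_of_nonneg_right _ hA'pos.le
          exact mul_le_mul (by norm_num) hK1 hK0.le (by positivity)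
  · calc (#(A' + A') : ℝ) ≤ 2 ^ 28 * K ^ 12 * #A' := hsum
      _ ≤ 2 ^ 28 * K ^ (2 ^ 28 : ℝ) * #A' := by
          apply mul_le_mul_of_nonneg_right _ hA'pos.le
          exact mul_le_mul_of_nonneg_left hK12 (by positivity)

end Literature.Combinatorics.Additive
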